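import Summits.BirchSwinnertonDyer.BirchSwinnertonDyer.Theorems.SignedLowerHalvesSprungLowerDivisibilityAtThreeCokerBoundSkeleton
import Literature.NumberTheory.EllipticCurves.Sprung2012.ColemanMapJointCokernelOfHondaProofs
import HarnessLib

/-!
# Crux `SprungLowerDivisibilityAtThree` (item stmt-BirchSwinnertonDyer-19875; x8 children 22569 `KatoFineLowerSporadicX8` /
# 22901 `CyclotomicLowerPosLevelX8`), line `chromatic-common-zeros`: the COKERNEL SKELETON behind F-α in the functional
# model of `H¹_Iw(ℚ_p, T)` with its joint-Coleman inputs `J` / `hJ` / `hcoker` discharged UNCONDITIONALLY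

Cell `bsd-ssimc` (host), width seat `cruxlead-stmt-BirchSwinnertonDyer-19875-w2` (gen 8) under the 19875 LEAD; `--supports`
stmt-BirchSwinnertonDyer-22569 `--as helper`; theorems only (no `def`, no named fact, no instance); closes NO item.

WHAT THIS IS. The sibling file `…CokerBoundFunctionalModel` (w3 g7) feeds the cokernel skeleton
`min_lengthAt_quotient_range_le_lengthAt_torsion_of_skeleton` (w3 g6, p652444) with the joint Coleman map of the tree's
functional model of `H¹_Iw(ℚ_p, T)` (`localTowerPointsOfEmb κ ι W →+ ℤ_p`, `Λ`-structure `Sprung2012.moduleOfGenerator`),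
CONDITIONALLY on the cite-only named fact `silvermanVII63_localLayerPoints_finiteIndex_zpLattice` (used there to discharge the
point-independence clause (IND) of the cokernel computation). THIS file removes that condition: the cokernel half of the
Kurihara–Pollack sequence `0 → H¹_Iw(T) → Λ² → ℤ_p → 0` — `J` `Λ`-linear and injective, `T·Λ² ⊆ im J`, `ℓ_𝔭(Λ²/im J) = 0`
at every prime `𝔭 ∌ T` — is now the unconditional theorem `Sprung2012.exists_linearMap_isColemanPair_cokernel_of_hondaSystem_rat`
(w2 g8, files `Sprung2012/{ColemanOrbitLayerTwoProofs, ColemanOrbitLayerTwoModPProofs, ColemanOrbitSecondGeneratorProofs,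
ColemanOrbitLayerTwoIndependenceProofs, HondaOrbitRankOfFunctionalsProofs, ColemanMapJointCokernelOfHondaProofs}.lean`: the
rank of the Honda orbit matrix is derived in-tree from the `Λ`-orbit of the functional `z₀` of Prop. 7.3, the saturation
clause of the Honda system, and `Φ_{p²}(1) = p`). Composing exactly as in the sibling file gives the two theorems below with
the hypothesis `h63` GONE; their remaining hypotheses are Kato's side only (`𝐇¹` cyclic, `loc`, Poitou–Tate exactness at
`H¹_Iw`, the colour values being the Coleman values of `loc`, non-vanishing at the generator) — displayed, as before.

HONEST FRAMING: unconditional on the Coleman side; what is STILL displayed for F-α (child stub `stub_cokerBoundIotaOffT`):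
Kato's `𝐇¹` cyclic with `loc` into the functional model and Poitou–Tate exactness there (Kato (17.13.1)), the identification
of the package colour maps `C•.colMap` with Coleman values of `loc`, and Wingberg/Matar (`ℓ_𝔭 tors X ≤ ℓ_𝔭 Y`). Nothing
about any curve's Selmer group is computed; K_spor, S4b-cyc, K1, leaf X8 and BSD are NOT proved by anything here.

References: [Sprung2012] Thm. 2.2, Lemma 2.3, Def. 5.9, §7.1 Props. 7.3/7.6, Def. 7.1–7.2; [KuriharaPollack2007] Prop. 1.2;
[LeiSujatha2021] (SES-KP), (PT); [Kato2004Asterisque] Thm. 12.4 (3), (17.13.1); [Wingberg1989] Cor. 2.5; [Matar2020] Thm. 1.1;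
tree: `…CokerBoundSkeleton` (p652444), `…CokerBoundFunctionalModel`, `Sprung2012/ColemanMapJointCokernelOfHondaProofs.lean`.
-/

set_option linter.dupNamespace false
set_option autoImplicit false

noncomputable section

open scoped Classical NumberField

open NumberField IsDedekindDomain Literature.NumberTheory.EllipticCurves Literature.NumberTheory.EllipticCurves.Sprung2012
  Literature.NumberTheory.EllipticCurves.ZpExtension Literature.NumberTheory.EllipticCurves.Kobayashi2003

namespace Summit.BirchSwinnertonDyer.BirchSwinnertonDyer.Theorems.ChromaticCommonZeros

universe v w

/-- **The cokernel skeleton in the functional model of `H¹_Iw(ℚ_p,T)`, joint-Coleman inputs discharged UNCONDITIONALLY.**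
`W/ℚ` elliptic globally minimal, `p ≠ 2` good supersingular, `κ` any `ℤ_p`-extension of `ℚ`, `v ∋ p`, `g` a local lift of the
topological generator, `(c₋₁, c)` a Honda system; `P = (E(ℚ_∞·ℚ_p) →+ ℤ_p)` with the `Λ`-structure `moduleOfGenerator`. GIVEN
(Kato's side, displayed): a CYCLIC `Λ`-module `H = Λ·h₀`, `loc : H → P` and `toX : P → X` exact at `P` (Poitou–Tate), colour
maps `cs, cf : H → Λ` whose values at `h` are the Coleman values of `loc h` (`IsColemanPair`), non-zero at `h₀`; THEN at every
height-one prime `𝔭 ∌ T`: `min(ℓ_𝔭 Λ/range cs, ℓ_𝔭 Λ/range cf) ≤ ℓ_𝔭(tors X)`. Proof: `min_lengthAt_quotient_range_le_lengthAt_torsion_of_skeleton`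
with `J`, `hJ` (injective) and `hcoker` (`ℓ_𝔭(Λ²/range J) = 0` off `(T)`) supplied by
`Sprung2012.exists_linearMap_isColemanPair_cokernel_of_hondaSystem_rat`, and `cs = (J∘loc).1`, `cf = (J∘loc).2` by uniqueness
of Coleman values. [cite: Sprung2012, Def. 5.9 (p. 1495), §7.1 Props. 7.3/7.6 (pp. 1500–1501), Thm. 2.2 / Lemma 2.3 (p. 1487)]
[cite: KuriharaPollack2007, Prop. 1.2] [cite: LeiSujatha2021, (SES-KP), (PT)] [cite: Kato2004Asterisque, Thm. 12.4 (3), (17.13.1)] -/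
theorem min_lengthAt_quotient_range_le_lengthAt_torsion_of_functionalModel_of_hondaSystem
    (W : WeierstrassCurve ℚ) [W.IsElliptic] [W.IsGloballyMinimal] (p : ℕ) [Fact p.Prime] (hp2 : p ≠ 2)
    (hgood : W.HasGoodReductionAtPrime p) (hap : (p : ℤ) ∣ W.frobeniusTrace p) (κ : ZpExtension ℚ p)
    {v : HeightOneSpectrum (𝓞 ℚ)} (hpv : (p : 𝓞 ℚ) ∈ v.asIdeal)
    {g : Field.absoluteGaloisGroup (v.adicCompletion ℚ)}
    (hg : κ.IsTopGenerator (resGalOfEmb (closureEmb (K := ℚ) (v.adicCompletion ℚ)) g))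
    {cneg : localPoints W (v.adicCompletion ℚ)} {c : ℕ → localPoints W (v.adicCompletion ℚ)}
    (hH : IsHondaSystem κ (closureEmb (K := ℚ) (v.adicCompletion ℚ)) W (W.frobeniusTrace p) g cneg c) :
    letI := moduleOfGenerator κ (closureEmb (K := ℚ) (v.adicCompletion ℚ)) W hg
    ∀ {H : Type v} {X : Type w} [AddCommGroup H] [Module (IwasawaAlgebra p) H] [AddCommGroup X]
      [Module (IwasawaAlgebra p) X]
      (loc : H →ₗ[IwasawaAlgebra p]
        (localTowerPointsOfEmb κ (closureEmb (K := ℚ) (v.adicCompletion ℚ)) W →+ ℤ_[p]))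
      (toX : (localTowerPointsOfEmb κ (closureEmb (K := ℚ) (v.adicCompletion ℚ)) W →+ ℤ_[p]) →ₗ[IwasawaAlgebra p] X),
      Function.Exact loc toX →
    ∀ (cs cf : H →ₗ[IwasawaAlgebra p] IwasawaAlgebra p),
      (∀ h, IsColemanPair κ (closureEmb (K := ℚ) (v.adicCompletion ℚ)) W (W.frobeniusTrace p) g c (loc h) (cs h) (cf h)) →
    ∀ (h₀ : H), (∀ h : H, ∃ r : IwasawaAlgebra p, r • h₀ = h) → cs h₀ ≠ 0 → cf h₀ ≠ 0 →
    ∀ (𝔭 : PrimeSpectrum (IwasawaAlgebra p)), 𝔭.asIdeal.height = 1 →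
      (PowerSeries.X : IwasawaAlgebra p) ∉ 𝔭.asIdeal →
      min (Module.lengthAt (IwasawaAlgebra p) (IwasawaAlgebra p ⧸ LinearMap.range cs) 𝔭)
          (Module.lengthAt (IwasawaAlgebra p) (IwasawaAlgebra p ⧸ LinearMap.range cf) 𝔭) ≤
        Module.lengthAt (IwasawaAlgebra p) (Submodule.torsion (IwasawaAlgebra p) X) 𝔭 := by
  letI := moduleOfGenerator κ (closureEmb (K := ℚ) (v.adicCompletion ℚ)) W hg
  intro H X _ _ _ _ loc toX hexact cs cf hcol h₀ hcyc hs0 hf0 𝔭 h𝔭 hT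
  obtain ⟨J, hJ, hinj, -, hcoker⟩ := exists_linearMap_isColemanPair_cokernel_of_hondaSystem_rat W p hp2 hgood hap κ hpv hg hH
  have hcs : ∀ h, cs h = (J (loc h)).1 := fun h =>
    (IsColemanPair.unique κ (closureEmb (K := ℚ) (v.adicCompletion ℚ)) W hap (hcol h) (hJ (loc h))).1
  have hcf : ∀ h, cf h = (J (loc h)).2 := fun h =>
    (IsColemanPair.unique κ (closureEmb (K := ℚ) (v.adicCompletion ℚ)) W hap (hcol h) (hJ (loc h))).2
  exact min_lengthAt_quotient_range_le_lengthAt_torsion_of_skeleton loc toX hexact J hinj cs cf hcs hcf h₀ hcyc hs0 hf0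
    𝔭 h𝔭 (hcoker 𝔭 hT)

/-- **F-α in the functional model with Wingberg/Matar displayed, unconditionally on the Coleman side** (`ℓ_𝔭(tors X) ≤ ℓ_𝔭 Y`
for the `γ`-keyed fine datum at the same prime): `min(ℓ_𝔭 Λ/range cs, ℓ_𝔭 Λ/range cf) ≤ ℓ_𝔭 Y` at every height-one `𝔭 ∌ T`.
[cite: Wingberg1989, Cor. 2.5] [cite: Matar2020, Thm. 1.1] [cite: Sprung2012, §7.1 Props. 7.3/7.6]
[cite: KuriharaPollack2007, Prop. 1.2] -/
theorem min_lengthAt_quotient_range_le_of_functionalModel_of_torsion_le_of_hondaSystem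
    (W : WeierstrassCurve ℚ) [W.IsElliptic] [W.IsGloballyMinimal] (p : ℕ) [Fact p.Prime] (hp2 : p ≠ 2)
    (hgood : W.HasGoodReductionAtPrime p) (hap : (p : ℤ) ∣ W.frobeniusTrace p) (κ : ZpExtension ℚ p)
    {v : HeightOneSpectrum (𝓞 ℚ)} (hpv : (p : 𝓞 ℚ) ∈ v.asIdeal)
    {g : Field.absoluteGaloisGroup (v.adicCompletion ℚ)}
    (hg : κ.IsTopGenerator (resGalOfEmb (closureEmb (K := ℚ) (v.adicCompletion ℚ)) g))
    {cneg : localPoints W (v.adicCompletion ℚ)} {c : ℕ → localPoints W (v.adicCompletion ℚ)}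
    (hH : IsHondaSystem κ (closureEmb (K := ℚ) (v.adicCompletion ℚ)) W (W.frobeniusTrace p) g cneg c) :
    letI := moduleOfGenerator κ (closureEmb (K := ℚ) (v.adicCompletion ℚ)) W hg
    ∀ {H : Type v} {X : Type w} [AddCommGroup H] [Module (IwasawaAlgebra p) H] [AddCommGroup X]
      [Module (IwasawaAlgebra p) X] {Y : Type w} [AddCommGroup Y] [Module (IwasawaAlgebra p) Y]
      (loc : H →ₗ[IwasawaAlgebra p]
        (localTowerPointsOfEmb κ (closureEmb (K := ℚ) (v.adicCompletion ℚ)) W →+ ℤ_[p]))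
      (toX : (localTowerPointsOfEmb κ (closureEmb (K := ℚ) (v.adicCompletion ℚ)) W →+ ℤ_[p]) →ₗ[IwasawaAlgebra p] X),
      Function.Exact loc toX →
    ∀ (cs cf : H →ₗ[IwasawaAlgebra p] IwasawaAlgebra p),
      (∀ h, IsColemanPair κ (closureEmb (K := ℚ) (v.adicCompletion ℚ)) W (W.frobeniusTrace p) g c (loc h) (cs h) (cf h)) →
    ∀ (h₀ : H), (∀ h : H, ∃ r : IwasawaAlgebra p, r • h₀ = h) → cs h₀ ≠ 0 → cf h₀ ≠ 0 →
    ∀ (𝔭 : PrimeSpectrum (IwasawaAlgebra p)), 𝔭.asIdeal.height = 1 →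
      (PowerSeries.X : IwasawaAlgebra p) ∉ 𝔭.asIdeal →
      Module.lengthAt (IwasawaAlgebra p) (Submodule.torsion (IwasawaAlgebra p) X) 𝔭 ≤
        Module.lengthAt (IwasawaAlgebra p) Y 𝔭 →
      min (Module.lengthAt (IwasawaAlgebra p) (IwasawaAlgebra p ⧸ LinearMap.range cs) 𝔭)
          (Module.lengthAt (IwasawaAlgebra p) (IwasawaAlgebra p ⧸ LinearMap.range cf) 𝔭) ≤
        Module.lengthAt (IwasawaAlgebra p) Y 𝔭 := by
  letI := moduleOfGenerator κ (closureEmb (K := ℚ) (v.adicCompletion ℚ)) W hg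
  intro H X _ _ _ _ Y _ _ loc toX hexact cs cf hcol h₀ hcyc hs0 hf0 𝔭 h𝔭 hT hWin
  exact (min_lengthAt_quotient_range_le_lengthAt_torsion_of_functionalModel_of_hondaSystem W p hp2 hgood hap κ hpv hg hH
    loc toX hexact cs cf hcol h₀ hcyc hs0 hf0 𝔭 h𝔭 hT).trans hWin

end Summit.BirchSwinnertonDyer.BirchSwinnertonDyer.Theorems.ChromaticCommonZeros

end
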